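import Literature.Geometry.Kaehler.AnalyticSetChain
import Literature.Geometry.Kaehler.HolomorphicChainRectifiable
import Literature.Geometry.Kaehler.LelongTheorem
import Literature.Geometry.Kaehler.HolomorphicChainFactsProofs
import Mathlib.Geometry.Euclidean.Volume.Measure
import Literature.Geometry.GeometricMeasureTheory.ApproxTangentChart
import Literature.Analysis.Calculus.AreaFormulaHausdorff
import HarnessLib

/-!
# The holomorphic chain of a complex plane

For a complex `p`-dimensional subspace `K` of the finite-dimensional complex inner product space
`V`, the subset `planeSet K = {x | ↑x ∈ K}` of the complex manifold `⊤ : Opens V` is an analytic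
set ALL of whose points are regular of codimension `dim V − p` (it is the zero set of a linear
surjection `V → ℂ^{dim V − p}` with kernel `K`), hence of pure dimension `p`
(`hasPureDim_planeSet`), and the holomorphic `p`-chain `[K] = HolomorphicChain.ofSet (planeSet K)`
(`AnalyticSetChain.lean`) — the **plane chain**, the tangent cone of a holomorphic chain at a
regular point — has

* carrier `K` (`carrier_plane`), density `1` on `K`, and, for its integer multiples
  `k • [K]`, a support (`∅` or `K`) invariant under complex homotheties (`smul_mem_support_plane`);
* current `[k • [K]](φ) = k ∫_K φ(y)(u₀, I u₀, …) d𝓗^{2p}(y) = k ∫_{x ∈ K} φ(x)(u₀, I u₀, …) dx`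
  for any unitary basis `u` of `K` (`toCurrentIn_smul_plane_apply`,
  `toCurrentIn_smul_plane_apply_volume`): the approximate tangent plane of `𝓗^{2p} ⌞ K` is `K`
  at every point (Federer 3.2.19 via `ApproxTangentChart.lean`), the orientation `2p`-vector is
  the canonical one of `K`, and `𝓗^{2p} ⌞ K` is the Lebesgue measure of `K` (area formula for the
  isometric inclusion).

## References

* H. Federer, *Geometric Measure Theory*, Springer 1969, 4.3.16–4.3.18 (tangent cones of analytic
  chains), 3.2.19, 3.2.3 [Federer1969].
* E. M. Chirka, *Complex Analytic Sets*, Kluwer 1989, §14.1, §11.5 [Chirka1989].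
-/

noncomputable section

open scoped Manifold Topology ENNReal NNReal InnerProductSpace
open Set Filter MeasureTheory Metric Function Module TopologicalSpace

namespace Literature.Geometry.Kaehler

universe u

variable {V : Type u} [NormedAddCommGroup V] [InnerProductSpace ℂ V] [FiniteDimensional ℂ V]

/-! ### The plane as an analytic subset of the manifold `⊤ : Opens V` -/

section PlaneSet

variable (K : Submodule ℂ V)

/-- The plane `K` as a subset of the complex manifold `⊤ : Opens V`. [folklore] -/
def planeSet : Set (⊤ : Opens V) := {x | (x : V) ∈ K}

omit [FiniteDimensional ℂ V] in
/-- `↑ '' planeSet K = K`. [folklore] -/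
theorem image_coe_planeSet : ((↑) : (⊤ : Opens V) → V) '' planeSet K = (K : Set V) := by
  ext v
  constructor
  · rintro ⟨x, hx, rfl⟩
    exact hx
  · intro hv
    exact ⟨⟨v, trivial⟩, hv, rfl⟩

omit [FiniteDimensional ℂ V] in
/-- Membership in `planeSet`. [folklore] -/
@[simp] theorem mem_planeSet {x : (⊤ : Opens V)} : x ∈ planeSet K ↔ (x : V) ∈ K := Iff.rfl

/-- A complex-linear surjection `L : V → ℂ^{dim V − dim K}` with kernel `K` (coordinates of the
orthogonal projection onto `Kᗮ`). [folklore] -/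
theorem exists_linear_surjective_ker_eq :
    ∃ L : V →L[ℂ] (Fin (finrank ℂ V - finrank ℂ K) → ℂ), Surjective L ∧
      ∀ v, L v = 0 ↔ v ∈ K := by
  have hdim : finrank ℂ Kᗮ = finrank ℂ V - finrank ℂ K := by
    have := K.finrank_add_finrank_orthogonal
    omega
  set b : Basis (Fin (finrank ℂ V - finrank ℂ K)) ℂ Kᗮ := Module.finBasisOfFinrankEq ℂ Kᗮ hdim
  refine ⟨(b.equivFun : Kᗮ →ₗ[ℂ] _).toContinuousLinearMap.comp Kᗮ.orthogonalProjectionOnto, ?_, ?_⟩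
  · intro c
    refine ⟨((b.equivFun.symm c : Kᗮ) : V), ?_⟩
    simp only [ContinuousLinearMap.coe_comp, comp_apply, LinearMap.coe_toContinuousLinearMap',
      LinearEquiv.coe_coe, Submodule.orthogonalProjectionOnto_mem_subspace_eq_self,
      LinearEquiv.apply_symm_apply]
  · intro v
    simp only [ContinuousLinearMap.coe_comp, comp_apply, LinearMap.coe_toContinuousLinearMap',
      LinearEquiv.coe_coe, map_eq_zero_iff _ b.equivFun.injective]
    rw [Submodule.orthogonalProjectionOnto_eq_zero_iff, Submodule.orthogonal_orthogonal]

/-- Every point of `planeSet K` is a regular point of codimension `dim V − dim K`, in the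
model-space sense, of `K ⊆ V`. [folklore] -/
theorem isRegPt_plane (v : V) :
    SCV.IsRegPt (K : Set V) (finrank ℂ V - finrank ℂ K) v := by
  obtain ⟨L, hL, hker⟩ := exists_linear_surjective_ker_eq K
  refine ⟨univ, isOpen_univ, mem_univ v, L, L.differentiable.differentiableOn, ?_, ?_⟩
  · ext w
    simp [hker]
  · rw [L.fderiv]
    exact hL

/-- `planeSet K` is an analytic subset of `⊤ : Opens V`. [folklore] -/
theorem isAnalyticSet_planeSet : IsAnalyticSet 𝓘(ℂ, V) (planeSet K) := by
  obtain ⟨L, -, hker⟩ := exists_linear_surjective_ker_eq K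
  have hc : ContMDiff 𝓘(ℂ, V) 𝓘(ℂ, Fin (finrank ℂ V - finrank ℂ K) → ℂ) ⊤
      (fun x : (⊤ : Opens V) => L (x : V)) :=
    L.contMDiff.comp contMDiff_subtype_val
  have hf : MDifferentiable 𝓘(ℂ, V) 𝓘(ℂ, Fin (finrank ℂ V - finrank ℂ K) → ℂ)
      (fun x : (⊤ : Opens V) => L (x : V)) :=
    hc.mdifferentiable (by simp)
  have h := isAnalyticSet_preimage_singleton_zero (I := 𝓘(ℂ, V)) hf
  have heq : (fun x : (⊤ : Opens V) => L (x : V)) ⁻¹' {0} = planeSet K := by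
    ext x
    simp [hker]
  rwa [heq] at h

/-- Every point of `planeSet K` is a regular point of codimension `dim V − dim K`. [folklore] -/
theorem isRegularPointOfCodim_planeSet (x : (⊤ : Opens V)) :
    IsRegularPointOfCodim 𝓘(ℂ, V) (planeSet K) (finrank ℂ V - finrank ℂ K) x := by
  refine isRegularPointOfCodim_of_isRegPt_chartImage (x := x) (by rw [Opens.extChartAt_source]; trivial) ?_
  rw [Opens.chartImage_eq, Opens.extChartAt_apply, image_coe_planeSet]
  exact isRegPt_plane K x

/-- `reg (planeSet K) = planeSet K`. [folklore] -/
theorem regularLocus_planeSet : regularLocus 𝓘(ℂ, V) (planeSet K) = planeSet K :=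
  Subset.antisymm (regularLocus_subset _) fun x hx => ⟨hx, _, isRegularPointOfCodim_planeSet K x⟩

/-- `planeSet K` has pure dimension `dim K`. [folklore] -/
theorem hasPureDim_planeSet {p : ℕ} (hK : finrank ℂ K = p) : HasPureDim 𝓘(ℂ, V) (planeSet K) p := by
  refine ⟨finrank ℂ V - finrank ℂ K, ?_, isAnalyticSet_planeSet K, ⟨⟨0, trivial⟩, ?_⟩,
    fun x _ => isRegularPointOfCodim_planeSet K x⟩
  · have := K.finrank_le
    omega
  · simp

end PlaneSet

/-! ### The plane chain and its multiples -/

namespace HolomorphicChain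

open Literature.Geometry.GeometricMeasureTheory

-- Nested operator-norm instances on `Covector V m`, as in `Currents.lean`.
set_option maxSynthPendingDepth 2

variable (K : Submodule ℂ V) {p : ℕ}

/-- **The plane chain** `[K]` of a complex `p`-plane `K`: the holomorphic `p`-chain on
`⊤ : Opens V` with the single component `K` and multiplicity `1`.
[cite: Federer1969, 4.3.18; Chirka1989, §11.5] -/
def plane (hK : finrank ℂ K = p) : HolomorphicChain 𝓘(ℂ, V) (⊤ : Opens V) p := ofSet (planeSet K) (hasPureDim_planeSet K hK)

/-- `|[K]| = K`. [folklore] -/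
theorem support_plane (hK : finrank ℂ K = p) : (plane K hK).support = planeSet K := support_ofSet _

/-- The carrier of `[K]` is `K`. [folklore] -/
theorem carrier_plane (hK : finrank ℂ K = p) : (plane K hK).carrier = (K : Set V) := by
  rw [plane, carrier_ofSet, regularLocus_planeSet, image_coe_planeSet]

/-- The density of `[K]` is `1` on `K`. [folklore] -/
theorem density_plane_of_mem (hK : finrank ℂ K = p) {v : V} (hv : v ∈ K) : (plane K hK).density v = 1 := by
  refine density_ofSet_of_mem_carrier _ ?_
  show v ∈ (plane K hK).carrier
  rw [carrier_plane]
  exact hv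

/-- The support of `k • [K]`: empty for `k = 0`, else `K`. [folklore] -/
theorem mem_support_smul_plane_iff (hK : finrank ℂ K = p) (k : ℤ) {x : (⊤ : Opens V)} :
    x ∈ (k • plane K hK).support ↔ k ≠ 0 ∧ (x : V) ∈ K := by
  rw [mem_support_iff]
  constructor
  · rintro ⟨Z, hZ, hxZ⟩
    rw [mult_zsmul, Pi.smul_apply, smul_eq_mul] at hZ
    refine ⟨left_ne_zero_of_mul hZ, ?_⟩
    have hx : x ∈ (plane K hK).support := mem_support_iff.2 ⟨Z, right_ne_zero_of_mul hZ, hxZ⟩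
    rwa [support_plane, mem_planeSet] at hx
  · rintro ⟨hk, hx⟩
    have hx' : x ∈ (plane K hK).support := by rwa [support_plane, mem_planeSet]
    obtain ⟨Z, hZ, hxZ⟩ := mem_support_iff.1 hx'
    exact ⟨Z, by rwa [mult_zsmul, Pi.smul_apply, smul_eq_mul, mul_ne_zero_iff, and_iff_right hk], hxZ⟩

/-- **The support of `k • [K]` is invariant under complex homotheties.** [folklore] -/
theorem smul_mem_support_smul_plane (hK : finrank ℂ K = p) (k : ℤ) {x : (⊤ : Opens V)} (hx : x ∈ (k • plane K hK).support)
    (c : ℂ) : (⟨c • (x : V), trivial⟩ : (⊤ : Opens V)) ∈ (k • plane K hK).support := by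
  rw [mem_support_smul_plane_iff] at hx ⊢
  exact ⟨hx.1, K.smul_mem c hx.2⟩

omit [FiniteDimensional ℂ V] in
/-- `0 • T = 0`. [folklore] -/
theorem zero_zsmul (T : HolomorphicChain 𝓘(ℂ, V) (⊤ : Opens V) p) : (0 : ℤ) • T = 0 :=
  mult_injective (by rw [mult_zsmul, zero_smul, mult_zero])

/-- The support of `k • [K]` equals that of `[K]` for `k ≠ 0`. [folklore] -/
theorem support_smul_plane (hK : finrank ℂ K = p) {k : ℤ} (hk : k ≠ 0) : (k • plane K hK).support = (plane K hK).support := by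
  ext x
  rw [mem_support_smul_plane_iff, support_plane, mem_planeSet, and_iff_right hk]

/-- The carrier of `k • [K]` is `K` for `k ≠ 0`. [folklore] -/
theorem carrier_smul_plane (hK : finrank ℂ K = p) {k : ℤ} (hk : k ≠ 0) : (k • plane K hK).carrier = (K : Set V) := by
  rw [← carrier_plane K hK, carrier, carrier, support_smul_plane K hK hk]

/-- The orientation frame of `k • [K]` is that of `[K]` for `k ≠ 0`. [folklore] -/
theorem orientationFrame_smul_plane (hK : finrank ℂ K = p) [MeasurableSpace V] [BorelSpace V] {k : ℤ} (hk : k ≠ 0) :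
    (k • plane K hK).orientationFrame = (plane K hK).orientationFrame := by
  funext x
  unfold orientationFrame
  rw [carrier_smul_plane K hK hk, carrier_plane K hK]

omit [FiniteDimensional ℂ V] in
/-- The density of `k • T` is `k` times the density of `T`. [folklore] -/
theorem density_zsmul (k : ℤ) (T : HolomorphicChain 𝓘(ℂ, V) (⊤ : Opens V) p) (x : V) :
    (k • T).density x = k * T.density x := by
  have h : ∀ Z : Set (⊤ : Opens V), (((↑) : (⊤ : Opens V) → V) '' Z).indicator
      (fun _ => k * T.mult Z) x = k * (((↑) : (⊤ : Opens V) → V) '' Z).indicator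
        (fun _ => T.mult Z) x := fun Z => by
    by_cases hx : x ∈ (((↑) : (⊤ : Opens V) → V) '' Z) <;> simp [hx]
  simp only [density, mult_zsmul, Pi.smul_apply, smul_eq_mul]
  rw [finsum_congr h, ← mul_finsum]

/-! ### The approximate tangent plane and the orientation of `𝓗^{2p} ⌞ K` -/

variable [MeasurableSpace V] [BorelSpace V]

/-- **The approximate tangent cone of `𝓗^{2p} ⌞ K` at a point of `K` is `K`.**
[cite: Federer1969, 3.2.19] -/
theorem approxTangentCone_plane_eq (hK : finrank ℂ K = p) {v : V} (hv : v ∈ K) :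
    approxTangentCone (2 * p) ((μHE[2 * p] : Measure V).restrict (K : Set V)) v = (K : Set V) := by
  letI iK : InnerProductSpace ℝ K := InnerProductSpace.complexToReal
  have hK2 : finrank ℝ K = 2 * p := by
    rw [finrank_real_of_complex, hK]
  -- the isometric inclusion and the orthogonal projection
  set g : K → V := fun x => (x : V) with hg
  set ℓ : V → K := fun y => K.orthogonalProjectionOnto y with hℓ
  have hℓ1 : LipschitzWith 1 ℓ := by
    refine LipschitzWith.of_dist_le_mul fun y y' => ?_
    rw [NNReal.coe_one, one_mul, dist_eq_norm, dist_eq_norm, hℓ]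
    simp only [← map_sub]
    exact K.norm_orthogonalProjectionOnto_apply_le _ |>.trans (le_of_eq rfl)
  have hgL : LipschitzOnWith 1 g univ := by
    refine LipschitzOnWith.of_dist_le_mul fun x _ x' _ => ?_
    simp [hg, Subtype.dist_eq]
  have hℓg : ∀ s ∈ (univ : Set K), ℓ (g s) = s := fun s _ => by
    simp [hℓ, hg]
  set t : K := ⟨v, hv⟩ with ht
  have hgt : g t = v := rfl
  set g' : K →L[ℝ] V := (K.subtypeL : K →L[ℂ] V).restrictScalars ℝ with hg'
  have hd : HasFDerivAt g g' t := (K.subtypeL.restrictScalars ℝ).hasFDerivAt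
  have hC : g '' univ ⊆ (K : Set V) := by
    rintro _ ⟨x, -, rfl⟩
    exact x.2
  have hCm : MeasurableSet (K : Set V) := K.closed_of_finiteDimensional.measurableSet
  set F : V → V := fun y => y - g (ℓ y) with hF
  set ℓ' : V →L[ℝ] K := (K.orthogonalProjectionOnto : V →L[ℂ] K).restrictScalars ℝ with hℓ'
  have hFd : HasFDerivAt F (ContinuousLinearMap.id ℝ V - g'.comp ℓ') (g t) :=
    (hasFDerivAt_id _).sub ((K.subtypeL.restrictScalars ℝ).hasFDerivAt.comp _
      (K.orthogonalProjectionOnto.restrictScalars ℝ).hasFDerivAt)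
  have hCU : (K : Set V) ∩ univ ⊆ {y | F y = F (g t)} := by
    rintro y ⟨hy, -⟩
    obtain ⟨w, rfl⟩ : ∃ w : K, (w : V) = y := ⟨⟨y, hy⟩, rfl⟩
    simp only [mem_setOf_eq, hF, hg, hℓ, Submodule.orthogonalProjectionOnto_mem_subspace_eq_self,
      sub_self]
  have hker : ∀ y, (ContinuousLinearMap.id ℝ V - g'.comp ℓ') y = 0 → y ∈ range g' := by
    intro y hy
    rw [_root_.sub_apply, sub_eq_zero] at hy
    exact ⟨ℓ' y, hy.symm⟩
  have key := approxTangentCone_eq_range_fderiv hℓ1 univ_mem hgL hℓg hd hC hCm MeasurableSet.univ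
    univ_mem hFd hCU hker
  rw [hK2, hgt] at key
  rw [key]
  ext y
  constructor
  · rintro ⟨x, rfl⟩
    exact x.2
  · intro hy
    exact ⟨⟨y, hy⟩, rfl⟩

/-- **The orientation `2p`-vector of `[K]` is the canonical `2p`-vector of `K`**: for a unitary
basis `u` of `K`, `ξ₁ ∧ ⋯ ∧ ξ_{2p} = u₀ ∧ I u₀ ∧ ⋯` at every point of `K`.
[cite: Federer1969, 4.2.29; Chirka1989, §14.1] -/
theorem frameVector_orientationFrame_plane (hK : finrank ℂ K = p) {u : Fin p → V}
    (hu : Orthonormal ℂ u)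
    (hspan : ((Submodule.span ℝ (Set.range (complexFrame u)) : Submodule ℝ V) : Set V) = (K : Set V))
    {v : V} (hv : v ∈ K) :
    frameVector ((plane K hK).orientationFrame v) = frameVector (complexFrame u) := by
  refine (plane K hK).frameVector_orientationFrame hu ?_
  rw [carrier_plane, approxTangentCone_plane_eq K hK hv]
  exact hspan

/-! ### The current of `k • [K]` -/

/-- **The current of the plane chain**: for every open `Ω'`, every `k : ℤ` and every test
`2p`-form `φ` on `Ω'`, `[k • [K]](φ) = k ∫_K φ(y)(u₀, I u₀, …) d𝓗^{2p}(y)` for any unitary basis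
`u` of `K`. [cite: Federer1969, 4.3.18, 4.1.28; Chirka1989, §14.1] -/
theorem toCurrentIn_smul_plane_apply (hK : finrank ℂ K = p) {u : Fin p → V} (hu : Orthonormal ℂ u)
    (hspan : ((Submodule.span ℝ (Set.range (complexFrame u)) : Submodule ℝ V) : Set V) = (K : Set V))
    (k : ℤ) (Ω' : Opens V) (φ : TestForm Ω' (2 * p)) :
    (k • plane K hK).toCurrentIn Ω' φ =
      (k : ℝ) * ∫ y in (K : Set V), φ y (complexFrame u) ∂(μHE[2 * p] : Measure V) := by
  by_cases hk : k = 0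
  · subst hk
    rw [zero_zsmul, toCurrentIn_zero]
    simp
  · set T := k • plane K hK with hT
    have hli := HolomorphicChain.locallyIntegrableOn_of_lelong
      Lelong1957_hausdorffMeasure_inter_lt_top_holds T
    have hli' : LocallyIntegrableOn
        (fun x => (T.density x : ℝ) • frameVector (T.orientationFrame x)) (Ω' : Set V)
        ((μHE[2 * p] : Measure V).restrict T.carrier) := hli.mono_set (subset_univ _)
    show currentOfIntegration T.carrier T.density T.orientationFrame φ = _
    rw [currentOfIntegration_apply hli', hT, carrier_smul_plane K hK hk]
    have hKm : MeasurableSet (K : Set V) := K.closed_of_finiteDimensional.measurableSet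
    have hpt : ∀ y ∈ (K : Set V), ((k • plane K hK).density y : ℝ) * φ y
        ((k • plane K hK).orientationFrame y) = (k : ℝ) * φ y (complexFrame u) := by
      intro y hy
      rw [density_zsmul, density_plane_of_mem K hK hy, mul_one, orientationFrame_smul_plane K hK hk]
      congr 1
      have h1 := congrArg (fun M : Multivector V (2 * p) => M (φ y))
        (frameVector_orientationFrame_plane K hK hu hspan hy)
      simpa only [frameVector_apply] using h1
    rw [setIntegral_congr_fun hKm hpt, integral_const_mul]

/-- **`𝓗^{2p} ⌞ K` is the Lebesgue measure of `K`**: `∫_K G d𝓗^{2p} = ∫_{x ∈ K} G(x) dx` (the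
inclusion is an isometry onto `K`). [cite: Federer1969, 3.2.3] -/
theorem setIntegral_plane_eq_integral (hK : finrank ℂ K = p) (G : V → ℝ) :
    letI : InnerProductSpace ℝ K := InnerProductSpace.complexToReal
    ∫ y in (K : Set V), G y ∂(μHE[2 * p] : Measure V) = ∫ x : K, G x := by
  letI iK : InnerProductSpace ℝ K := InnerProductSpace.complexToReal
  have hK2 : finrank ℝ K = 2 * p := by rw [finrank_real_of_complex, hK]
  have hiso : Isometry ((↑) : K → V) := isometry_subtype_coe
  have hmap := hiso.map_euclideanHausdorffMeasure (d := 2 * p)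
  rw [Subtype.range_coe] at hmap
  have hemb : MeasurableEmbedding ((↑) : K → V) := hiso.isClosedEmbedding.measurableEmbedding
  rw [← hmap, hemb.integral_map]
  congr 1
  rw [← hK2, InnerProductSpace.euclideanHausdorffMeasure_eq_volume]

/-- The current of the plane chain in the parametrised form
`[k • [K]](φ) = k ∫_{x ∈ K} φ(x)(u₀, I u₀, …) dx`. [cite: Federer1969, 4.3.18, 4.1.28] -/
theorem toCurrentIn_smul_plane_apply_volume (hK : finrank ℂ K = p) {u : Fin p → V}
    (hu : Orthonormal ℂ u)
    (hspan : ((Submodule.span ℝ (Set.range (complexFrame u)) : Submodule ℝ V) : Set V) = (K : Set V))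
    (k : ℤ) (Ω' : Opens V) (φ : TestForm Ω' (2 * p)) :
    letI : InnerProductSpace ℝ K := InnerProductSpace.complexToReal
    (k • plane K hK).toCurrentIn Ω' φ = (k : ℝ) * ∫ x : K, φ x (complexFrame u) := by
  rw [toCurrentIn_smul_plane_apply K hK hu hspan, setIntegral_plane_eq_integral K hK]

end HolomorphicChain

end Literature.Geometry.Kaehler
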